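import Literature.AlgebraicGeometry.RelativeSpec.FiniteGroupQuotientGenericEtale
import Literature.AlgebraicGeometry.RelativeSpec.GeometricQuotientRecognition
import Literature.AlgebraicGeometry.RelativeSpec.FiniteGroupQuotientGluedProperties
import Literature.AlgebraicGeometry.Motives.RatFnSpec
import Mathlib.FieldTheory.Fixed
import HarnessLib

/-!
# The function field of a finite-group quotient: `K(X/G) = K(X)^G` and `[K(X) : K(X/G)] = |G|`
# (SGA 1, Exp. V, §1–2; Mumford, *Abelian Varieties* §7; E. Artin)

Let the finite group `G` act on the INTEGRAL scheme `X` over a base `Y` (`ActionOver r G`) and let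
`p : X → Q` be a GEOMETRIC QUOTIENT (`ActionOver.IsGeometricQuotient`, `RelativeSpec/GeometricQuotient`:
`p` invariant, surjective, open, fibres = orbits, `𝒪_Q = (p_*𝒪_X)^G`), `Q` integral.  Then

* `functionFieldMap_aut_comp_functionFieldMap` — `g♯ ∘ p♯ = p♯` on `K(Q) → K(X)`;
* `mem_range_functionFieldMap_iff` — a rational function on `X` descends to `Q` iff it is fixed by every
  `g♯` (**descent of invariant rational functions**: an invariant germ at the generic point is the germ of an
  invariant section over some `p⁻¹W`, which descends by `IsGeometricQuotient.exists_app_eq`);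
* `finrank_functionField` — if the action is faithful on `K(X)` (`g♯ ≠ id` for `g ≠ 1`; for a
  faithful `G → Aut X` over a separated base this is `functionFieldMap_ne_id_of_injective`), then
  **`[K(X) : K(Q)] = |G|`** (E. Artin's theorem `FixedPoints.finrank_eq_card` applied to the action
  `g ↦ (g⁻¹)♯` of `G` on `K(X)`, whose fixed field is `p♯ K(Q)` by the previous item);
* `finrank_functionField_glued` — the case of Mumford's glued quotient `π : X → X/G`
  (`ActionOver.gluedMk`, a geometric quotient by `isGeometricQuotient_gluedMk`) for a faithful
  `G → Aut X`.

This is the degree statement `deg(X → X/G) = |G|` in the function-field currency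
`Module.finrank K(Q) K(X)` of `Motives/CartierDivisorProjectionFormula`
(`CartierDivisor.map_cycle_pullback_eq_smul`), used for the ramification count of a Galois cover of
curves (`p^*[q] = Σ_{δ} [δ w]`).  Everything is proved; no named facts, no definitions (the action of `G`
on `K(X)` is assembled inside the proofs from `functionFieldMap`).  The analytic counterpart for compact
Riemann surfaces is `Geometry/Kaehler/RiemannSurfaceOrbitSurfaceFunctionFieldGalois`.

## References

* J.-P. Serre, *Algebraic Groups and Class Fields*, GTM 117 (1988), Ch. III no. 12, Prop. 18, Cor. b)
  («if `V` is irreducible, so is `V/𝔤`, and `k(V/𝔤) = k(V)^𝔤`») and Remark 1 (validity beyond the affine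
  case). [Serre1988]
* A. Grothendieck, M. Raynaud, *SGA 1*, Exp. V, §1 Prop. 1.1 (`𝒪_Y = p_*(𝒪_X)^G`). [SGA1]
* D. Mumford, *Abelian Varieties* (1970), §7, Thm. p. 66 (2). [MumfordAV1970]
* E. Artin's theorem `[F : F^G] = |G|` is Mathlib's `FixedPoints.finrank_eq_card`.
-/

noncomputable section

universe u

open CategoryTheory Limits AlgebraicGeometry
open Literature.AlgebraicGeometry.Motives Literature.AlgebraicGeometry.Motives.RatFn

namespace Literature.AlgebraicGeometry.RelativeSpec

namespace ActionOver

namespace IsGeometricQuotient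


variable {X Y : Scheme.{u}} {r : X ⟶ Y} {G : Type*} [Group G] {ρ : ActionOver r G}
  [IsIntegral X] {Q : Scheme.{u}} [IsIntegral Q] {p : X ⟶ Q} [IsDominant p]
  (h : ρ.IsGeometricQuotient p)
include h

/-- **`g♯ ∘ p♯ = p♯`**: rational functions pulled back from the quotient are invariant.
[cite: Serre1988, Ch. III no. 12, Prop. 18 Cor. b)] -/
theorem functionFieldMap_aut_comp_functionFieldMap (g : G) :
    (functionFieldMap (ρ.aut g).hom).comp (functionFieldMap p) = functionFieldMap p := by
  rw [← functionFieldMap_comp]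
  exact functionFieldMap_congr (h.comp_eq g)

/-- Pointwise form of `functionFieldMap_aut_comp_functionFieldMap`. [cite: Serre1988, Ch. III no. 12, Prop. 18 Cor. b)] -/
theorem functionFieldMap_aut_apply (g : G) (b : Q.functionField) :
    functionFieldMap (ρ.aut g).hom (functionFieldMap p b) = functionFieldMap p b :=
  DFunLike.congr_fun (h.functionFieldMap_aut_comp_functionFieldMap g) b


/-- **Descent of invariant rational functions, `K(Q) = K(X)^G`** (Serre: «`k(V/𝔤) = k(V)^𝔤`»; SGA 1, V,
Prop. 1.1 `𝒪_Y = p_*(𝒪_X)^G` read at the generic point): a rational function on `X` is pulled back from the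
geometric quotient `Q` iff it is fixed by every `g♯`. [cite: Serre1988, Ch. III no. 12, Prop. 18 Cor. b)]
[cite: SGA1, Exp. V, Prop. 1.1] -/
theorem mem_range_functionFieldMap_iff [Finite G] (a : X.functionField) :
    a ∈ Set.range (functionFieldMap p) ↔ ∀ g : G, functionFieldMap (ρ.aut g).hom a = a := by
  classical
  constructor
  · rintro ⟨b, rfl⟩ g
    exact h.functionFieldMap_aut_apply g b
  intro ha
  haveI : Fintype G := Fintype.ofFinite G
  set ξ := genericPoint X with hξ
  -- `a` is the germ of a section `s` over an open `V ∋ ξ`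
  obtain ⟨V, hV, s, rfl⟩ := exists_germ_genericPoint_eq a
  -- the `G`-stable open `V'' = ⋂ g⁻¹ V ∋ ξ`
  let V'' : X.Opens := Finset.univ.inf fun g : G => (ρ.aut g).hom ⁻¹ᵁ V
  have hmem : ∀ y : X, y ∈ V'' ↔ ∀ g : G, (ρ.aut g).hom y ∈ V := fun y => by
    rw [← SetLike.mem_coe, TopologicalSpace.Opens.coe_finset_inf, Finset.inf_eq_iInf]
    simp only [Function.comp_apply, Set.iInf_eq_iInter, Set.mem_iInter, SetLike.mem_coe,
      Finset.mem_univ, forall_const]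
    rfl
  have hξV'' : ξ ∈ V'' := (hmem ξ).mpr fun g => by rw [ρ.aut_apply_genericPoint]; exact hV
  have hV''V : V'' ≤ V := fun y hy => by
    have := (hmem y).mp hy 1
    rwa [map_one] at this
  have hstab : ∀ (g : G) (y : X), y ∈ V'' → (ρ.aut g).hom y ∈ V'' := fun g y hy => by
    rw [hmem] at hy ⊢
    intro g'
    rw [← Scheme.Hom.comp_apply, ρ.aut_hom_comp_aut_hom']
    exact hy (g' * g)
  -- the open `W = p(V'')` of `Q`; `p⁻¹W ≤ V'' ≤ V`
  let W : Q.Opens := ⟨p.base '' (V'' : Set X), h.isOpenMap _ V''.isOpen⟩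
  have hWV'' : p ⁻¹ᵁ W ≤ V'' := by
    rintro x ⟨y, hy, hxy⟩
    obtain ⟨g, rfl⟩ := h.exists_aut_apply_eq hxy
    exact hstab g y hy
  have hWV : p ⁻¹ᵁ W ≤ V := hWV''.trans hV''V
  have hξW : ξ ∈ p ⁻¹ᵁ W := ⟨ξ, hξV'', rfl⟩
  have hξQ : genericPoint Q ∈ W := by
    rw [← genericPoint_eq_of_isDominant p]; exact hξW
  -- the restricted section `s' = s|_{p⁻¹W}` is invariant on the nose
  let s' : Γ(X, p ⁻¹ᵁ W) := X.presheaf.map (homOfLE hWV).op s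
  have hs' : X.presheaf.germ (p ⁻¹ᵁ W) ξ hξW s' = X.presheaf.germ V ξ hV s :=
    TopCat.Presheaf.germ_res_apply X.presheaf _ _ _ _
  have hinv : ∀ (g : G) (e : p ⁻¹ᵁ W ≤ (ρ.aut g⁻¹).hom ⁻¹ᵁ (p ⁻¹ᵁ W)),
      (ρ.aut g⁻¹).hom.appLE (p ⁻¹ᵁ W) (p ⁻¹ᵁ W) e s' = s' := by
    intro g e
    apply germ_injective_of_isIntegral X ξ hξW
    rw [germ_appLE_eq_functionFieldMap (ρ.aut g⁻¹).hom e hξW hξW s', hs']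
    exact ha g⁻¹
  -- so it descends to a section `t` of `Q` over `W`, whose germ maps to `a`
  obtain ⟨t, ht⟩ := h.exists_app_eq W s' hinv
  refine ⟨Q.presheaf.germ W (genericPoint Q) hξQ t, ?_⟩
  rw [← germ_appLE_eq_functionFieldMap p le_rfl hξQ hξW t, ← Scheme.Hom.app_eq_appLE, ht, hs']

/-- **`[K(X) : K(Q)] = |G|`** for a geometric quotient `p : X → Q` of an integral scheme by a finite group
acting faithfully on the function field: E. Artin's theorem for the action `g ↦ (g⁻¹)♯` of `G` on `K(X)`,
whose fixed field is `p♯ K(Q)` (`mem_range_functionFieldMap_iff`, Serre's `k(V/𝔤) = k(V)^𝔤`).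
[cite: Serre1988, Ch. III no. 12, Prop. 18 Cor. b)] [cite: MumfordAV1970, §7 Thm. p. 66 (2)] -/
theorem finrank_functionField [Fintype G]
    (hfaith : ∀ g : G, g ≠ 1 → functionFieldMap (ρ.aut g).hom ≠ RingHom.id _) :
    letI := (functionFieldMap p).toAlgebra
    Module.finrank Q.functionField X.functionField = Fintype.card G := by
  classical
  set L := X.functionField with hL
  -- the action `g ↦ (g⁻¹)♯` of `G` on `L = K(X)` by field automorphisms
  let e : G → L ≃+* L := fun g =>
    RingEquiv.ofRingHom (functionFieldMap (ρ.aut g⁻¹).hom) (functionFieldMap (ρ.aut g).hom)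
      (by rw [← functionFieldMap_comp, functionFieldMap_congr (ρ.aut_hom_comp_aut_hom' g⁻¹ g),
            mul_inv_cancel, functionFieldMap_congr (show (ρ.aut (1 : G)).hom = 𝟙 X by rw [map_one]; rfl)]
          exact functionFieldMap_id)
      (by rw [← functionFieldMap_comp, functionFieldMap_congr (ρ.aut_hom_comp_aut_hom' g g⁻¹),
            inv_mul_cancel, functionFieldMap_congr (show (ρ.aut (1 : G)).hom = 𝟙 X by rw [map_one]; rfl)]
          exact functionFieldMap_id)
  have he : ∀ g (a : L), e g a = functionFieldMap (ρ.aut g⁻¹).hom a := fun _ _ => rfl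
  let σ : G →* (L ≃+* L) :=
    { toFun := e
      map_one' := by
        ext a
        change functionFieldMap (ρ.aut (1 : G)⁻¹).hom a = a
        rw [functionFieldMap_congr (show (ρ.aut (1 : G)⁻¹).hom = 𝟙 X by rw [inv_one, map_one]; rfl),
          functionFieldMap_id, RingHom.id_apply]
      map_mul' := fun g g' => by
        ext a
        change functionFieldMap (ρ.aut (g * g')⁻¹).hom a =
          functionFieldMap (ρ.aut g⁻¹).hom (functionFieldMap (ρ.aut g'⁻¹).hom a)
        rw [← RingHom.comp_apply, ← functionFieldMap_comp,
          functionFieldMap_congr (ρ.aut_hom_comp_aut_hom' g⁻¹ g'⁻¹), ← mul_inv_rev] }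
  letI : MulSemiringAction G L := MulSemiringAction.compHom L σ
  have hsmul : ∀ (g : G) (a : L), g • a = functionFieldMap (ρ.aut g⁻¹).hom a := fun _ _ => rfl
  haveI : FaithfulSMul G L := ⟨fun {g₁ g₂} hg => by
    by_contra hne
    have H : functionFieldMap (ρ.aut g₁⁻¹).hom = functionFieldMap (ρ.aut g₂⁻¹).hom :=
      RingHom.ext fun a => hg a
    apply hfaith (g₁ * g₂⁻¹) (fun h1 => hne (mul_inv_eq_one.mp h1))
    rw [functionFieldMap_congr (ρ.aut_hom_comp_aut_hom' g₂⁻¹ g₁).symm, functionFieldMap_comp, ← H,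
      ← functionFieldMap_comp, functionFieldMap_congr (ρ.aut_hom_comp_aut_hom' g₁⁻¹ g₁), mul_inv_cancel,
      functionFieldMap_congr (show (ρ.aut (1 : G)).hom = 𝟙 X by rw [map_one]; rfl)]
    exact functionFieldMap_id⟩
  -- the fixed field is `p♯ K(Q)`
  have hfix : ∀ a : L, a ∈ FixedPoints.subfield G L ↔ a ∈ Set.range (functionFieldMap p) := by
    intro a
    rw [h.mem_range_functionFieldMap_iff, show a ∈ FixedPoints.subfield G L ↔ ∀ g : G, g • a = a from
      MulAction.mem_fixedPoints]
    constructor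
    · intro H g; simpa [hsmul] using H g⁻¹
    · intro H g; rw [hsmul]; exact H g⁻¹
  -- `K(Q) ≃ K(X)^G` over `K(X)`
  let i₀ : Q.functionField →+* FixedPoints.subfield G L :=
    (functionFieldMap p).codRestrict _ fun b => (hfix _).mpr ⟨b, rfl⟩
  have hi₀ : Function.Bijective i₀ := by
    refine ⟨fun b₁ b₂ hb => (functionFieldMap p).injective (congrArg Subtype.val hb), fun a => ?_⟩
    obtain ⟨b, hb⟩ := (hfix a.1).mp a.2
    exact ⟨b, Subtype.ext hb⟩
  let i : Q.functionField ≃+* FixedPoints.subfield G L := RingEquiv.ofBijective i₀ hi₀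
  letI := (functionFieldMap p).toAlgebra
  rw [Algebra.finrank_eq_of_equiv_equiv i (RingEquiv.refl L) (by ext b; rfl)]
  exact FixedPoints.finrank_eq_card G L

end IsGeometricQuotient

/-! ### Mumford's glued quotient `X → X/G` -/

section Glued

variable {X Y : Scheme.{u}} {r : X ⟶ Y} {G : Type*} [Group G] [Fintype G] (ρ : ActionOver r G)
  [IsIntegral X] [Y.IsSeparated] [IsSeparated r] [IsAffine Y]
  (hcov : ∀ x : X, ∃ O : ρ.StableAffineOpens, x ∈ O.1)


/-- **`[K(X) : K(X/G)] = |G|`** for Mumford's quotient `π : X → X/G` of an integral scheme, separated over an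
affine separated base and covered by `G`-stable affine opens, by a finite group `G → Aut X` acting
FAITHFULLY. [cite: MumfordAV1970, §7 Thm. p. 66 (2)] [cite: Serre1988, Ch. III no. 12, Prop. 18 Cor. b)] -/
theorem finrank_functionField_glued (hρ : Function.Injective ρ.aut) :
    haveI : IsIntegral ρ.glued := ρ.isIntegral_glued hcov
    letI := (functionFieldMap (ρ.gluedMk hcov)).toAlgebra
    Module.finrank ρ.glued.functionField X.functionField = Fintype.card G := by
  haveI : IsIntegral ρ.glued := ρ.isIntegral_glued hcov
  exact (ρ.isGeometricQuotient_gluedMk hcov).finrank_functionField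
    (ρ.functionFieldMap_ne_id_of_injective hρ)

end Glued

end ActionOver

end Literature.AlgebraicGeometry.RelativeSpec

end
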